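import Literature.NumberTheory.EllipticCurves.ModularFormsLevelRankGeneral
import Mathlib.RingTheory.RootsOfUnity.PrimitiveRoots
import Mathlib.RingTheory.RootsOfUnity.Complex
import Mathlib.LinearAlgebra.Matrix.SpecialLinearGroup
import Mathlib.Tactic.LinearCombination
import HarnessLib

/-!
# Venture HSemireg — VANISHING OF AN `SL(2,ℤ)`-INVARIANT FUNCTION OF WEIGHT `k` AT THE CM POINTS `ρ` AND `i`

The two-line «modular weight» argument (LEMMA CM, Proof 1 of `widen/W1/POLISHCHUK-CM-w1aut2.md` §2,
seat w1-aut-2 of the computation cell `pub-hsemireg`; companion of `RootWeightLaw.lean`, which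
records Proof 2's character step) in kernel form, typed by the literature seat lit-w-polishchuk-orlov
(g10). SETTING AS PRINTED [Polishchuk2011AInfinityEllipticEisenstein, §1.1; arXiv:0911.2814v3 p. 2
L3–7]: a function `F(ω₁, ω₂)` on oriented bases of `ℂ` «is said to be of weight `k ∈ ℤ` if
`F(λω₁, λω₂) = λ^{−k} F(ω₁, ω₂)`», and «modular (with respect to `SL(2, ℤ)`) if it is invariant
with respect to `SL(2, ℤ)` base changes of `(ω₁, ω₂)`» (plus a cusp condition not used here); the
Weil operator `W` «is `SL(2,ℤ)`-invariant and is of weight two», `e₂*` is invariant of weight `2`,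
`e_{2k}` is modular of weight `2k`, and `g_{a,b} = (b − a)! W^a(e*_{b−a+1})` (ibid. p. 2 L43–59) —
so `g_{a,b}` is an `SL(2,ℤ)`-invariant function of weight `a + b + 1`.

WHAT IS PROVED (elementary; DERIVED statements, labelled so — the classical `E₄(ρ) = 0`,
`E₆(i) = 0` mechanism; not a quotation). For `F : 𝕜 → 𝕜 → 𝕜` over a field `𝕜`, «weight `k`» is
taken in the inverse-free form `λ^k · F(λa, λb) = F(a, b)` (`λ ≠ 0`), on ALL pairs (the
oriented-basis restriction is immaterial for the algebra), and invariance is assumed only under the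
ONE integral unimodular move actually used:
* `apply_eq_zero_of_weight_of_fixed` — the core: if `c^k · F(ca, cb) = F(a, b)` and the point is
  FIXED up to the scalar `c` by an invariance (`F(ca, cb) = F(a, b)`), then `c^k ≠ 1 ⇒ F(a,b) = 0`;
* `apply_one_cubeRoot_eq_zero` — invariance under `(ω₁, ω₂) ↦ (ω₂, −ω₁ − ω₂)` (the matrix
  `[[0,1],[−1,−1]] ∈ SL(2,ℤ)` of Proof 1): for `ρ` a primitive cube root of unity,
  `(ρ, −1 − ρ) = (ρ·1, ρ·ρ)`, so `F(1, ρ) = 0` unless `3 ∣ k`;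
* `apply_one_sq_sixthRoot_eq_zero` — invariance under `(ω₁, ω₂) ↦ (ω₁ + ω₂, −ω₁)` (the order-`6`
  matrix `[[1,1],[−1,0]]`): for `ζ` a primitive sixth root of unity and `ρ = ζ²`,
  `(1 + ρ, −1) = (ζ·1, ζ·ρ)`, so `F(1, ζ²) = 0` unless `6 ∣ k` — parity and the cube-root condition in
  one stroke (Proof 1's «hence, if `k` is even, unless `6 ∣ k`»);
* `apply_one_fourthRoot_eq_zero` — invariance under `(ω₁, ω₂) ↦ (ω₂, −ω₁)` (`[[0,1],[−1,0]]`): for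
  `i` a primitive fourth root of unity, `(i, −1) = (i·1, i·i)`, so `F(1, i) = 0` unless `4 ∣ k`;
* `eq_zero_of_odd_weight` — invariance under `−1 ∈ SL(2,ℤ)` kills every function of ODD weight
  identically (characteristic `≠ 2`);
* the `ℂ` anchors `complex_apply_one_exp_eq_zero` (`ρ = exp(2πi/3) = ζ₆²`) and
  `complex_apply_one_I_eq_zero` (`IsPrimitiveRoot Complex.I 4` reused from the tree's
  `Literature.NumberTheory.EllipticCurves.ModularForms.Level.isPrimitiveRoot_I_four`);
* section `Modular`: the PRINTED hypothesis «invariant with respect to `SL(2,ℤ)` base changes of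
  `(ω₁, ω₂)`» stated inline for every `γ : SL(2, ℤ)` (Mathlib's `Matrix.SpecialLinearGroup`), the
  three moves obtained from the elements `[[1,1],[−1,0]]`, `[[0,1],[−1,0]]`, `−1` (written inline;
  the file declares theorems only, no `def`), and the packaged statements
  `modular_apply_one_sq_sixthRoot_eq_zero` / `modular_apply_one_fourthRoot_eq_zero` /
  `modular_eq_zero_of_odd_weight` / `modular_complex_anchors`.

USE IN THE CELL (the dictionary, NOT formalised here — `g_{a,b}` is an analytic object not in Mathlib):
with `F = g_{a,b}`, `k = a + b + 1`: `g_{a,b}(ℤ + ℤρ) = 0` unless `6 ∣ a + b + 1` and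
`g_{a,b}(ℤ + ℤi) = 0` unless `4 ∣ a + b + 1`; by [Polishchuk2011AInfinityEllipticEisenstein,
Thm 2.5.1] (constants `M(a,b,c,d) ∝ g_{a+c,b+d}` of weight `n − 2`, `n = a+b+c+d+3`) the harmonic
`A∞`-structure on `Ext*(𝒪 ⊕ L)`, `deg L = 1`, has `m_n = 0` at `E_ω` unless `n ≡ 2 (mod 6)` and at
`E_i` unless `n ≡ 2 (mod 4)` — W1's COROLLARY CM (locators re-read as printed in
`widen/LIT-W/LITW-READ-POLISHCHUK-CM-S1-litwpo-g10.md`).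
HONEST FRAMING: field arithmetic with roots of unity only; no lattice function, Eisenstein series,
`A∞`-structure, sheaf or semiregularity map is constructed here; nothing here says that HC, HC_CM or
HC_AV holds, and nothing here is a new case of anything.
-/

namespace Summit.Ventures.HSemireg

namespace ModularWeightCM

variable {𝕜 : Type*} [Field 𝕜]

/-- The core step: if rescaling by `c` reproduces `F(a,b)` up to the weight factor `c^k`
(`c^k · F(ca, cb) = F(a, b)`) AND an invariance fixes the point up to that scalar
(`F(ca, cb) = F(a, b)`), then `(c^k − 1) · F(a, b) = 0`. -/
theorem pow_sub_one_mul_apply_eq_zero (F : 𝕜 → 𝕜 → 𝕜) (k : ℕ) (a b c : 𝕜)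
    (hw : c ^ k * F (c * a) (c * b) = F a b) (hfix : F (c * a) (c * b) = F a b) :
    (c ^ k - 1) * F a b = 0 := by
  rw [hfix] at hw
  linear_combination hw

/-- … hence `F(a, b) = 0` as soon as `c^k ≠ 1`. -/
theorem apply_eq_zero_of_weight_of_fixed (F : 𝕜 → 𝕜 → 𝕜) (k : ℕ) (a b c : 𝕜)
    (hw : c ^ k * F (c * a) (c * b) = F a b) (hfix : F (c * a) (c * b) = F a b) (hc : c ^ k ≠ 1) :
    F a b = 0 := by
  rcases mul_eq_zero.mp (pow_sub_one_mul_apply_eq_zero F k a b c hw hfix) with h | h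
  · exact absurd (sub_eq_zero.mp h) hc
  · exact h

/-- A primitive cube root of unity satisfies `ρ² + ρ + 1 = 0`. -/
theorem sq_add_self_add_one_eq_zero {ρ : 𝕜} (hρ : IsPrimitiveRoot ρ 3) : ρ ^ 2 + ρ + 1 = 0 := by
  have h3 : ρ ^ 3 = 1 := hρ.pow_eq_one
  have h1 : ρ ≠ 1 := hρ.ne_one (by norm_num)
  have : (ρ - 1) * (ρ ^ 2 + ρ + 1) = 0 := by linear_combination h3
  rcases mul_eq_zero.mp this with h | h
  · exact absurd (sub_eq_zero.mp h) h1
  · exact h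

/-- A primitive sixth root of unity satisfies `ζ³ = −1` … -/
theorem cube_eq_neg_one_of_sixthRoot {ζ : 𝕜} (hζ : IsPrimitiveRoot ζ 6) : ζ ^ 3 = -1 := by
  have h6 : ζ ^ 6 = 1 := hζ.pow_eq_one
  have h3 : ζ ^ 3 ≠ 1 := hζ.pow_ne_one_of_pos_of_lt (by norm_num) (by norm_num)
  have : (ζ ^ 3 - 1) * (ζ ^ 3 + 1) = 0 := by linear_combination h6
  rcases mul_eq_zero.mp this with h | h
  · exact absurd (sub_eq_zero.mp h) h3
  · linear_combination h

/-- … and the sixth cyclotomic relation `ζ² − ζ + 1 = 0`. -/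
theorem sq_sub_self_add_one_eq_zero {ζ : 𝕜} (hζ : IsPrimitiveRoot ζ 6) : ζ ^ 2 - ζ + 1 = 0 := by
  have h2 : ζ ^ 2 ≠ 1 := hζ.pow_ne_one_of_pos_of_lt (by norm_num) (by norm_num)
  have : (ζ + 1) * (ζ ^ 2 - ζ + 1) = 0 := by
    linear_combination cube_eq_neg_one_of_sixthRoot hζ
  rcases mul_eq_zero.mp this with h | h
  · exfalso
    apply h2
    have hz : ζ = -1 := by linear_combination h
    rw [hz]
    norm_num
  · exact h

/-- A primitive fourth root of unity satisfies `i² = −1`. -/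
theorem sq_eq_neg_one_of_fourthRoot {i : 𝕜} (hi : IsPrimitiveRoot i 4) : i ^ 2 = -1 := by
  have h4 : i ^ 4 = 1 := hi.pow_eq_one
  have h2 : i ^ 2 ≠ 1 := hi.pow_ne_one_of_pos_of_lt (by norm_num) (by norm_num)
  have : (i ^ 2 - 1) * (i ^ 2 + 1) = 0 := by linear_combination h4
  rcases mul_eq_zero.mp this with h | h
  · exact absurd (sub_eq_zero.mp h) h2
  · linear_combination h

/-- **LEMMA CM, Proof 1, at `ρ` (order-`3` move).** If `F` has weight `k`
(`λ^k · F(λa, λb) = F(a, b)` for `λ ≠ 0`) and is invariant under the base change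
`(ω₁, ω₂) ↦ (ω₂, −ω₁ − ω₂)` (the matrix `[[0,1],[−1,−1]] ∈ SL(2,ℤ)`), then for a primitive cube root
of unity `ρ` — where `(ρ, −1 − ρ) = (ρ·1, ρ·ρ)` is again a basis of the lattice `ℤ + ℤρ` —
`F(1, ρ) = 0` unless `3 ∣ k`. -/
theorem apply_one_cubeRoot_eq_zero (F : 𝕜 → 𝕜 → 𝕜) (k : ℕ)
    (hw : ∀ l a b : 𝕜, l ≠ 0 → l ^ k * F (l * a) (l * b) = F a b)
    (hT : ∀ a b : 𝕜, F b (-a - b) = F a b)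
    {ρ : 𝕜} (hρ : IsPrimitiveRoot ρ 3) (hk : ¬ 3 ∣ k) : F 1 ρ = 0 := by
  have hrel := sq_add_self_add_one_eq_zero hρ
  have hρ0 : ρ ≠ 0 := hρ.ne_zero (by norm_num)
  refine apply_eq_zero_of_weight_of_fixed F k 1 ρ ρ (hw ρ 1 ρ hρ0) ?_ ?_
  · have e1 : ρ * 1 = ρ := mul_one ρ
    have e2 : ρ * ρ = -1 - ρ := by linear_combination hrel
    rw [e1, e2]
    exact hT 1 ρ
  · exact fun h => hk ((hρ.pow_eq_one_iff_dvd k).mp h)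

/-- **LEMMA CM, Proof 1, at `ρ = ζ²` with the order-`6` move** `(ω₁, ω₂) ↦ (ω₁ + ω₂, −ω₁)`
(`[[1,1],[−1,0]] ∈ SL(2,ℤ)`): for `ζ` a primitive sixth root of unity, `ρ := ζ²` is a primitive
cube root, `1 + ρ = ζ` and `ζρ = ζ³ = −1`, so `(1 + ρ, −1) = (ζ·1, ζ·ρ)` and a weight-`k`
function invariant under this move has `F(1, ρ) = 0` unless `6 ∣ k` (for even `k`: unless `3 ∣ k`;
for odd `k`: always — cf. `eq_zero_of_odd_weight`). -/
theorem apply_one_sq_sixthRoot_eq_zero (F : 𝕜 → 𝕜 → 𝕜) (k : ℕ)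
    (hw : ∀ l a b : 𝕜, l ≠ 0 → l ^ k * F (l * a) (l * b) = F a b)
    (hT : ∀ a b : 𝕜, F (a + b) (-a) = F a b)
    {ζ : 𝕜} (hζ : IsPrimitiveRoot ζ 6) (hk : ¬ 6 ∣ k) : F 1 (ζ ^ 2) = 0 := by
  have hrel := sq_sub_self_add_one_eq_zero hζ
  have hcube := cube_eq_neg_one_of_sixthRoot hζ
  have hζ0 : ζ ≠ 0 := hζ.ne_zero (by norm_num)
  refine apply_eq_zero_of_weight_of_fixed F k 1 (ζ ^ 2) ζ (hw ζ 1 (ζ ^ 2) hζ0) ?_ ?_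
  · have e1 : ζ * 1 = 1 + ζ ^ 2 := by linear_combination (-1 : 𝕜) * hrel
    have e2 : ζ * ζ ^ 2 = -1 := by linear_combination hcube
    rw [e1, e2]
    exact hT 1 (ζ ^ 2)
  · exact fun h => hk ((hζ.pow_eq_one_iff_dvd k).mp h)

/-- **LEMMA CM, Proof 1, at `i` (order-`4` move).** If `F` has weight `k` and is invariant under
`(ω₁, ω₂) ↦ (ω₂, −ω₁)` (`[[0,1],[−1,0]] ∈ SL(2,ℤ)`), then for a primitive fourth root of unity `i`
— where `(i, −1) = (i·1, i·i)` — `F(1, i) = 0` unless `4 ∣ k`. -/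
theorem apply_one_fourthRoot_eq_zero (F : 𝕜 → 𝕜 → 𝕜) (k : ℕ)
    (hw : ∀ l a b : 𝕜, l ≠ 0 → l ^ k * F (l * a) (l * b) = F a b)
    (hS : ∀ a b : 𝕜, F b (-a) = F a b)
    {i : 𝕜} (hi : IsPrimitiveRoot i 4) (hk : ¬ 4 ∣ k) : F 1 i = 0 := by
  have hrel := sq_eq_neg_one_of_fourthRoot hi
  have hi0 : i ≠ 0 := hi.ne_zero (by norm_num)
  refine apply_eq_zero_of_weight_of_fixed F k 1 i i (hw i 1 i hi0) ?_ ?_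
  · have e1 : i * 1 = i := mul_one i
    have e2 : i * i = -1 := by linear_combination hrel
    rw [e1, e2]
    exact hS 1 i
  · exact fun h => hk ((hi.pow_eq_one_iff_dvd k).mp h)

/-- Parity: a function of ODD weight `k` invariant under `−1 ∈ SL(2,ℤ)` (`(ω₁, ω₂) ↦ (−ω₁, −ω₂)`)
vanishes identically (characteristic `≠ 2`); this is the mechanism behind «all products `m_n` with
odd `n` vanish» on the Eisenstein-series side (`g_{a,b}` is only defined for `a + b + 1` even). -/
theorem eq_zero_of_odd_weight (F : 𝕜 → 𝕜 → 𝕜) (k : ℕ) (h2 : (2 : 𝕜) ≠ 0)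
    (hw : ∀ l a b : 𝕜, l ≠ 0 → l ^ k * F (l * a) (l * b) = F a b)
    (hN : ∀ a b : 𝕜, F (-a) (-b) = F a b) (hk : Odd k) (a b : 𝕜) : F a b = 0 := by
  have h := hw (-1) a b (by norm_num)
  rw [hk.neg_one_pow] at h
  simp only [neg_one_mul] at h
  rw [hN a b] at h
  -- h : -F a b = F a b
  have h' : (2 : 𝕜) * F a b = 0 := by linear_combination -h
  rcases mul_eq_zero.mp h' with h'' | h''
  · exact absurd h'' h2
  · exact h''

/-! ### The two CM anchors of the cell over `ℂ`: `E_ω` (`τ = ρ = e^{2πi/3}`) and `E_i` (`τ = i`) -/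

/-- At `E_ω`: with `ρ = exp(2πi/3) = ζ₆²` (`ζ₆ = exp(2πi/6)`), a weight-`k` function on `ℂ²`
invariant under `(ω₁, ω₂) ↦ (ω₁ + ω₂, −ω₁)` has `F(1, ρ) = 0` unless `6 ∣ k`. -/
theorem complex_apply_one_exp_eq_zero (F : ℂ → ℂ → ℂ) (k : ℕ)
    (hw : ∀ l a b : ℂ, l ≠ 0 → l ^ k * F (l * a) (l * b) = F a b)
    (hT : ∀ a b : ℂ, F (a + b) (-a) = F a b) (hk : ¬ 6 ∣ k) :
    F 1 (Complex.exp (2 * Real.pi * Complex.I / 3)) = 0 := by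
  have hζ : IsPrimitiveRoot (Complex.exp (2 * Real.pi * Complex.I / 6)) 6 :=
    Complex.isPrimitiveRoot_exp 6 (by norm_num)
  have hsq : Complex.exp (2 * Real.pi * Complex.I / 6) ^ 2 = Complex.exp (2 * Real.pi * Complex.I / 3) := by
    rw [← Complex.exp_nat_mul]
    congr 1
    push_cast
    ring
  rw [← hsq]
  exact apply_one_sq_sixthRoot_eq_zero F k hw hT hζ hk

/-- At `E_i`: a weight-`k` function on `ℂ²` invariant under `(ω₁, ω₂) ↦ (ω₂, −ω₁)` has
`F(1, i) = 0` unless `4 ∣ k` (`i` is a primitive fourth root of unity: the tree's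
`Literature.NumberTheory.EllipticCurves.ModularForms.Level.isPrimitiveRoot_I_four`). -/
theorem complex_apply_one_I_eq_zero (F : ℂ → ℂ → ℂ) (k : ℕ)
    (hw : ∀ l a b : ℂ, l ≠ 0 → l ^ k * F (l * a) (l * b) = F a b)
    (hS : ∀ a b : ℂ, F b (-a) = F a b) (hk : ¬ 4 ∣ k) : F 1 Complex.I = 0 :=
  apply_one_fourthRoot_eq_zero F k hw hS
    Literature.NumberTheory.EllipticCurves.ModularForms.Level.isPrimitiveRoot_I_four hk

/-! ### The printed hypothesis: invariance under ALL of `SL(2, ℤ)`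

[Polishchuk2011AInfinityEllipticEisenstein, §1.1]: «Such `F` is called modular (with respect to
`SL(2, ℤ)`) if it is invariant with respect to `SL(2, ℤ)` base changes of `(ω₁, ω₂)`» — here as the
hypothesis `hmod` (every `γ ∈ SL(2,ℤ)`, acting by `(ω₁, ω₂) ↦ (γ₀₀ω₁ + γ₀₁ω₂, γ₁₀ω₁ + γ₁₁ω₂)`; the
cusp condition of the printed definition is not needed), stated inline (no `def … : Prop`). The three
moves used above come from the elements `[[1,1],[−1,0]]` (order `6`, fixing `ρ = ζ₆²` up to the
scalar `ζ₆`), `[[0,1],[−1,0]]` (order `4`, fixing `i` up to the scalar `i`) and `−1` of `SL(2,ℤ)`. -/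

section Modular

open scoped MatrixGroups

/-- `SL(2,ℤ)`-invariance (the printed hypothesis) specialised to `[[1,1],[−1,0]]`. -/
theorem invariant_add_neg_of_modular (F : 𝕜 → 𝕜 → 𝕜)
    (hmod : ∀ γ : SL(2, ℤ), ∀ a b : 𝕜,
      F (((γ : Matrix (Fin 2) (Fin 2) ℤ) 0 0 : 𝕜) * a + ((γ : Matrix (Fin 2) (Fin 2) ℤ) 0 1 : 𝕜) * b)
        (((γ : Matrix (Fin 2) (Fin 2) ℤ) 1 0 : 𝕜) * a + ((γ : Matrix (Fin 2) (Fin 2) ℤ) 1 1 : 𝕜) * b)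
        = F a b)
    (a b : 𝕜) : F (a + b) (-a) = F a b := by
  have := hmod ⟨!![1, 1; -1, 0], by norm_num [Matrix.det_fin_two_of]⟩ a b
  simpa using this

/-- … specialised to `[[0,1],[−1,0]]`. -/
theorem invariant_swap_neg_of_modular (F : 𝕜 → 𝕜 → 𝕜)
    (hmod : ∀ γ : SL(2, ℤ), ∀ a b : 𝕜,
      F (((γ : Matrix (Fin 2) (Fin 2) ℤ) 0 0 : 𝕜) * a + ((γ : Matrix (Fin 2) (Fin 2) ℤ) 0 1 : 𝕜) * b)
        (((γ : Matrix (Fin 2) (Fin 2) ℤ) 1 0 : 𝕜) * a + ((γ : Matrix (Fin 2) (Fin 2) ℤ) 1 1 : 𝕜) * b)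
        = F a b)
    (a b : 𝕜) : F b (-a) = F a b := by
  have := hmod ⟨!![0, 1; -1, 0], by norm_num [Matrix.det_fin_two_of]⟩ a b
  simpa using this

/-- … specialised to `−1`. -/
theorem invariant_neg_neg_of_modular (F : 𝕜 → 𝕜 → 𝕜)
    (hmod : ∀ γ : SL(2, ℤ), ∀ a b : 𝕜,
      F (((γ : Matrix (Fin 2) (Fin 2) ℤ) 0 0 : 𝕜) * a + ((γ : Matrix (Fin 2) (Fin 2) ℤ) 0 1 : 𝕜) * b)
        (((γ : Matrix (Fin 2) (Fin 2) ℤ) 1 0 : 𝕜) * a + ((γ : Matrix (Fin 2) (Fin 2) ℤ) 1 1 : 𝕜) * b)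
        = F a b)
    (a b : 𝕜) : F (-a) (-b) = F a b := by
  have := hmod ⟨!![-1, 0; 0, -1], by norm_num [Matrix.det_fin_two_of]⟩ a b
  simpa using this

/-- **LEMMA CM (Proof 1), anchor `ρ`, printed hypothesis.** An `SL(2,ℤ)`-invariant function of
weight `k` vanishes at `(1, ρ)`, `ρ = ζ²` for `ζ` a primitive sixth root of unity, unless `6 ∣ k`
(so for `k = 4`: the printed `e₄(ρ) = 0`; the companions below give the anchor `i` and odd `k`). -/
theorem modular_apply_one_sq_sixthRoot_eq_zero (F : 𝕜 → 𝕜 → 𝕜) (k : ℕ)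
    (hw : ∀ l a b : 𝕜, l ≠ 0 → l ^ k * F (l * a) (l * b) = F a b)
    (hmod : ∀ γ : SL(2, ℤ), ∀ a b : 𝕜,
      F (((γ : Matrix (Fin 2) (Fin 2) ℤ) 0 0 : 𝕜) * a + ((γ : Matrix (Fin 2) (Fin 2) ℤ) 0 1 : 𝕜) * b)
        (((γ : Matrix (Fin 2) (Fin 2) ℤ) 1 0 : 𝕜) * a + ((γ : Matrix (Fin 2) (Fin 2) ℤ) 1 1 : 𝕜) * b)
        = F a b)
    {ζ : 𝕜} (hζ : IsPrimitiveRoot ζ 6) (hk : ¬ 6 ∣ k) : F 1 (ζ ^ 2) = 0 :=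
  apply_one_sq_sixthRoot_eq_zero F k hw (invariant_add_neg_of_modular F hmod) hζ hk

/-- **LEMMA CM (Proof 1), anchor `i`, printed hypothesis.** An `SL(2,ℤ)`-invariant function of
weight `k` vanishes at `(1, i)`, `i` a primitive fourth root of unity, unless `4 ∣ k`. -/
theorem modular_apply_one_fourthRoot_eq_zero (F : 𝕜 → 𝕜 → 𝕜) (k : ℕ)
    (hw : ∀ l a b : 𝕜, l ≠ 0 → l ^ k * F (l * a) (l * b) = F a b)
    (hmod : ∀ γ : SL(2, ℤ), ∀ a b : 𝕜,
      F (((γ : Matrix (Fin 2) (Fin 2) ℤ) 0 0 : 𝕜) * a + ((γ : Matrix (Fin 2) (Fin 2) ℤ) 0 1 : 𝕜) * b)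
        (((γ : Matrix (Fin 2) (Fin 2) ℤ) 1 0 : 𝕜) * a + ((γ : Matrix (Fin 2) (Fin 2) ℤ) 1 1 : 𝕜) * b)
        = F a b)
    {i : 𝕜} (hi : IsPrimitiveRoot i 4) (hk : ¬ 4 ∣ k) : F 1 i = 0 :=
  apply_one_fourthRoot_eq_zero F k hw (invariant_swap_neg_of_modular F hmod) hi hk

/-- **Odd weight, printed hypothesis.** An `SL(2,ℤ)`-invariant function of odd weight `k`
vanishes identically (characteristic `≠ 2`; the move is `−1 ∈ SL(2,ℤ)`). -/
theorem modular_eq_zero_of_odd_weight (F : 𝕜 → 𝕜 → 𝕜) (k : ℕ) (h2 : (2 : 𝕜) ≠ 0)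
    (hw : ∀ l a b : 𝕜, l ≠ 0 → l ^ k * F (l * a) (l * b) = F a b)
    (hmod : ∀ γ : SL(2, ℤ), ∀ a b : 𝕜,
      F (((γ : Matrix (Fin 2) (Fin 2) ℤ) 0 0 : 𝕜) * a + ((γ : Matrix (Fin 2) (Fin 2) ℤ) 0 1 : 𝕜) * b)
        (((γ : Matrix (Fin 2) (Fin 2) ℤ) 1 0 : 𝕜) * a + ((γ : Matrix (Fin 2) (Fin 2) ℤ) 1 1 : 𝕜) * b)
        = F a b)
    (hk : Odd k) (a b : 𝕜) : F a b = 0 :=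
  eq_zero_of_odd_weight F k h2 hw (invariant_neg_neg_of_modular F hmod) hk a b

/-- The two CM anchors over `ℂ` with the printed hypothesis: an `SL(2,ℤ)`-invariant weight-`k`
function on `ℂ²` has `F(1, e^{2πi/3}) = 0` unless `6 ∣ k` and `F(1, i) = 0` unless `4 ∣ k`. -/
theorem modular_complex_anchors (F : ℂ → ℂ → ℂ) (k : ℕ)
    (hw : ∀ l a b : ℂ, l ≠ 0 → l ^ k * F (l * a) (l * b) = F a b)
    (hmod : ∀ γ : SL(2, ℤ), ∀ a b : ℂ,
      F (((γ : Matrix (Fin 2) (Fin 2) ℤ) 0 0 : ℂ) * a + ((γ : Matrix (Fin 2) (Fin 2) ℤ) 0 1 : ℂ) * b)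
        (((γ : Matrix (Fin 2) (Fin 2) ℤ) 1 0 : ℂ) * a + ((γ : Matrix (Fin 2) (Fin 2) ℤ) 1 1 : ℂ) * b)
        = F a b) :
    (¬ 6 ∣ k → F 1 (Complex.exp (2 * Real.pi * Complex.I / 3)) = 0) ∧
      (¬ 4 ∣ k → F 1 Complex.I = 0) :=
  ⟨fun hk => complex_apply_one_exp_eq_zero F k hw (invariant_add_neg_of_modular F hmod) hk,
   fun hk => complex_apply_one_I_eq_zero F k hw (invariant_swap_neg_of_modular F hmod) hk⟩

end Modular

end ModularWeightCM

end Summit.Ventures.HSemireg
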